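import Summits.AtomisticToContinuum.Crystallization.Theses.PalmUnimodularRigidity
import Summits.AtomisticToContinuum.Crystallization.Theorems.MinimiserShells.Negative.LoadBearing
import Summits.AtomisticToContinuum.Crystallization.Theorems.PalmUnimodularRigidityMinimiserShellsSlackEventTransfer
import Summits.AtomisticToContinuum.Crystallization.Theorems.PalmUnimodularRigidityMinimiserShellsThresholdTransfer
import Summits.AtomisticToContinuum.Crystallization.Theorems.PalmUnimodularRigidityMinimiserShellsThresholdOfQualShellNoBoundary
import Summits.AtomisticToContinuum.Crystallization.Theorems.PalmUnimodularRigidityMinimiserShellsQualShellNoBoundaryOfQualShellGapWith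
import Summits.AtomisticToContinuum.Crystallization.Theorems.PalmUnimodularRigidityMinimiserShellsQualShellNoBoundaryOfPeriodicShellGap
import Summits.AtomisticToContinuum.Crystallization.Theorems.PalmUnimodularRigidityMinimiserShellsPeriodicShellGapOfQualShellNoBoundary

/-!
# Crux `MinimiserShells` (stmt-AtomisticToContinuum-9225) follows from the PERIODIC SHELL GAP

Line `equilibrium-in-law-surgery`, reshape r5 (lead `…-c3-0`).  Crux decl
`Summit.AtomisticToContinuum.Crystallization.Theses.PalmUnimodularRigidity.MinimiserShells`.

All transfers of the line are landed theorems (S1 a.s. e*-`μ`GSC, S2 = 9229, S5 measurability, S8a slack event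
transfer, S8b threshold transfer, S11 finite no-boundary qualitative shell gap ⇒ threshold pricing, S13 periodic
shell gap ⇒ finite no-boundary gap, S14 converse, S12 allowance removal).  This file composes them into the
quotable reductions of the crux to ONE statement about periodic configurations of `ℝ³` only:

**Periodic shell gap** (the line's residual stub `stub_periodicShellGap`, S7‴; OPEN — it is bulk energetic
crystallization of three-dimensional Lennard-Jones in shell form, Blanc–Lewin 2015 §2.3): for every `t > 0` there is
`κ > 0` such that every periodic configuration `Q` with at least `t·#motif` motif sites badly shelled in `Q.points`
(`¬ GoodShell (count|((· − x) '' Q.points))`) has `e* + κ ≤ e(Q)`.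

* `minimiserShells_of_periodicShellGap` : periodic shell gap → `MinimiserShells` (S13, S11, S8b, S8a);
* `periodicShellGap_iff_qualShellNoBoundary` : periodic shell gap ↔ finite no-boundary qualitative shell gap (S13, S14);
* `periodicShellGap_iff_qualShellGapWith` : periodic shell gap ↔ finite qualitative shell gap with `C₀·N^{2/3}`
  boundary allowance (S12, S14, and the trivial direction `C₀ = 0`);
so the three classical finite/periodic forms of "near-minimisers are mostly close-packed-shelled" coincide, and each
implies the measure-level crux.
-/

noncomputable section

open MeasureTheory
open scoped ENNReal BigOperators Classical

namespace Summit.AtomisticToContinuum.Crystallization.Theorems.PalmUnimodularRigidityMinimiserShells.OfPeriodicShellGap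

open Literature.MathematicalPhysics.StatisticalMechanics (lennardJones interactionEnergy PeriodicConfiguration)
open Summit.AtomisticToContinuum.Crystallization.Theses.PalmUnimodularRigidity (MinimiserShells)
open Summit.AtomisticToContinuum.Crystallization.Theorems.MinimiserShells.Negative.LoadBearing (eStar GoodShell)

/-- **Periodic shell gap ⇒ `MinimiserShells`.**  If for every `t > 0` some `κ > 0` separates from `e*` the energy
per particle of every periodic configuration with at least `t·#motif` badly-shelled motif sites, then every
minimising point-stationary hard-core law has almost surely a close-packed root shell.  Composition of the landed
transfers S13 (`PeriodicShellGap.stub_qualShellNoBoundary_of_periodicShellGap`), S11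
(`QualShellNoBoundary.stub_thresholdBadPricing_of_qualShellNoBoundary`), S8b (`ThresholdTransfer.stub_thresholdTransfer`)
and S8a (`SlackEventTransfer.stub_slackEventTransfer`). -/
theorem minimiserShells_of_periodicShellGap :
    (∀ t : ℝ, 0 < t → ∃ κ : ℝ, 0 < κ ∧ ∀ Q : PeriodicConfiguration 3,
      t * (Q.motif.card : ℝ) ≤ (Nat.card {x : Q.motif // ¬ GoodShell
          ((Measure.count : Measure (EuclideanSpace ℝ (Fin 3))).restrict
            ((fun z => z - (x : EuclideanSpace ℝ (Fin 3))) '' Q.points))} : ℝ) →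
      eStar + κ ≤ Q.energyPerParticle lennardJones) →
    MinimiserShells :=
  fun hPer => ThresholdTransfer.stub_thresholdTransfer SlackEventTransfer.stub_slackEventTransfer
    (QualShellNoBoundary.stub_thresholdBadPricing_of_qualShellNoBoundary
      (PeriodicShellGap.stub_qualShellNoBoundary_of_periodicShellGap hPer))

/-- **Periodic shell gap ⇔ finite no-boundary qualitative shell gap** (S13 ∧ S14): "every periodic configuration
with bad-shell fraction `≥ t` has `e(Q) ≥ e* + κ_t`" iff "every finite injective configuration with at least `t·N`
badly-shelled sites has `𝓔_N ≥ N·(e* + κ'_t)`". -/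
theorem periodicShellGap_iff_qualShellNoBoundary :
    (∀ t : ℝ, 0 < t → ∃ κ : ℝ, 0 < κ ∧ ∀ Q : PeriodicConfiguration 3,
      t * (Q.motif.card : ℝ) ≤ (Nat.card {x : Q.motif // ¬ GoodShell
          ((Measure.count : Measure (EuclideanSpace ℝ (Fin 3))).restrict
            ((fun z => z - (x : EuclideanSpace ℝ (Fin 3))) '' Q.points))} : ℝ) →
      eStar + κ ≤ Q.energyPerParticle lennardJones) ↔
    (∀ t : ℝ, 0 < t → ∃ κ : ℝ, 0 < κ ∧ ∀ (N : ℕ) (y : Fin N → EuclideanSpace ℝ (Fin 3)), Function.Injective y →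
      t * (N : ℝ) ≤ (Nat.card {i : Fin N // ¬ GoodShell
          ((Measure.count : Measure (EuclideanSpace ℝ (Fin 3))).restrict ((fun z => z - y i) '' Set.range y))} : ℝ) →
      (N : ℝ) * (eStar + κ) ≤ interactionEnergy lennardJones y) :=
  ⟨PeriodicShellGap.stub_qualShellNoBoundary_of_periodicShellGap,
    PeriodicShellGapConverse.stub_periodicShellGap_of_qualShellNoBoundary⟩

/-- **Periodic shell gap ⇔ finite qualitative shell gap WITH boundary allowance `C₀·N^{2/3}`** (the classical
form "`𝓔_N(y_N)/N → e*` forces `#bad(y_N)/N → 0`"): `←` through S12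
(`QualShellGapAmplification.stub_qualShellNoBoundary_of_qualShellGapWith`) and S14; `→` through S13 with `C₀ = 0`. -/
theorem periodicShellGap_iff_qualShellGapWith :
    (∀ t : ℝ, 0 < t → ∃ κ : ℝ, 0 < κ ∧ ∀ Q : PeriodicConfiguration 3,
      t * (Q.motif.card : ℝ) ≤ (Nat.card {x : Q.motif // ¬ GoodShell
          ((Measure.count : Measure (EuclideanSpace ℝ (Fin 3))).restrict
            ((fun z => z - (x : EuclideanSpace ℝ (Fin 3))) '' Q.points))} : ℝ) →
      eStar + κ ≤ Q.energyPerParticle lennardJones) ↔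
    (∀ t : ℝ, 0 < t → ∃ κ C₀ : ℝ, 0 < κ ∧ ∀ (N : ℕ) (y : Fin N → EuclideanSpace ℝ (Fin 3)),
      Function.Injective y →
      t * (N : ℝ) ≤ (Nat.card {i : Fin N // ¬ GoodShell
          ((Measure.count : Measure (EuclideanSpace ℝ (Fin 3))).restrict ((fun z => z - y i) '' Set.range y))} : ℝ) →
      (N : ℝ) * (eStar + κ) - C₀ * (N : ℝ) ^ (2 / 3 : ℝ) ≤ interactionEnergy lennardJones y) := by
  constructor
  · intro hPer t ht
    obtain ⟨κ, hκ, h⟩ := PeriodicShellGap.stub_qualShellNoBoundary_of_periodicShellGap hPer t ht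
    refine ⟨κ, 0, hκ, fun N y hy hbad => ?_⟩
    have := h N y hy hbad
    simpa using this
  · intro hGap
    exact PeriodicShellGapConverse.stub_periodicShellGap_of_qualShellNoBoundary
      (QualShellGapAmplification.stub_qualShellNoBoundary_of_qualShellGapWith hGap)

end Summit.AtomisticToContinuum.Crystallization.Theorems.PalmUnimodularRigidityMinimiserShells.OfPeriodicShellGap

end
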